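import Summits.HodgeConjecture.HodgeConjecture.Theorems.K2LiuDoubledSeesawBothSlots
import Summits.HodgeConjecture.HodgeConjecture.Theorems.K2LiuLineThetaKernelMirror
import Literature.NumberTheory.K2Lit.DoubledLineThetaKernel
import Literature.NumberTheory.Automorphic.Liu2021.ThetaLiftFromLineSeamFrameTransport
import HarnessLib

/-!
# Undoubling of D8's doubled line-theta kernel on block-diagonal elements: `θ^𝔻_{Φ₁ ⊠ Φ₂}(diag(k₁,k₂), u) = θ^{V₁}_{Φ₁}(k₁, u) · θ^{V₂}_{Φ₂}(k₂, u)`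
# — organ (O44d′) of socket #44∕45R, the D8-frame read-back of ★ `omega_chiSplitting_sumTensor_idxSplit₂`

Track B ∕ hLiu418 = stmt-HodgeConjecture-24832, line `K2_Liu_CurveThetaSigs`, unit U6 ED. 6, socket #44∕45R `sig_K2LiuUndoublingSeparation`;
seat `hodgecm-mathlib-K2Liu-p03` (g3).  The doubled coefficients of ★ D8 `K2Lit/DoubledLineThetaKernel` are `dD = (t₀ ‖ −t₀) ∘ finSumFinEquiv⁻¹`
(`t₀ = cmGramEntry`), so `U(diag dD)` IS the orthogonal-sum frame `V₁ ⊕ V₂` of ★ `GelbartRogawski1991/DoubledBlockDiagEmbedding` with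
`dA := dD ∘ Fin.castAdd n`, `dB := dD ∘ Fin.natAdd n` (the two hypotheses `hVA`, `hVB` hold by `rfl`).  This file reads the both-slot
identity ★ `K2LiuDoubledSeesawBothSlots.omega_chiSplitting_sumTensor_idxSplit₂` in that frame:

* §1 `reindex_kronecker_blockDiag` — the matrix bookkeeping `reindex e_Σ e_Σ (h ⊗ u) = diag(k₁ ⊗ u, k₂ ⊗ u)` for `h = reindex e₂ (diag(k₁, k₂))`
  (the shape of ★ `coe_iotaGG`: `ι(x₁,x₂) = reindex e₂ (diag(reindex e x₁, reindex e x₂))`), and `coe_adelicInl_mul_adelicInr` (`(k ⊗ 1)(1 ⊗ u) = k ⊗ u`);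
* §2 `omega_chiSplitting_dD_blockDiag` — for `h ∈ U(diag dD)(𝔸)` with `GL`-matrix `reindex e₂ (diag(k₁, k₂))`, `k_j ∈ U(diag d_j)(𝔸)`, and `u ∈ U(diag dW′)(𝔸)`:
  `ω(s_χ^{dD}(h ⊗ 1 · 1 ⊗ u)) (Φ₁ ⊠_ι Φ₂) = ω(s_χ^{dA}(k₁ ⊗ 1 · 1 ⊗ u)) Φ₁ ⊠_ι ω(s_χ^{dB}(k₂ ⊗ 1 · 1 ⊗ u)) Φ₂`, `ι = idxSplit e_D e_A e_B`;
* §3 `thetaDistLM_sumTensor` (`Θ(Ψ₁ ⊠_ι Ψ₂) = Θ(Ψ₁)·Θ(Ψ₂)`, the theta series of a pure tensor is the product — the sum over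
  `(L⁺)^{n″} = (L⁺)^{n₁} × (L⁺)^{n₂}`) and the KERNEL-LEVEL product formula **`lineThetaKer_dD_blockDiag`**: for the letter's line-theta data
  ★ `lineThetaKernelDatum` at the doubled frame `(n+n, e_D, dD)` and at the slots `(n, e_A, dA)`, `(n, e_B, dB)` (same line `⟨a′⟩`, same `μ`),
  `θ^{dD}_{Φ₁ ⊠_ι Φ₂}(mk h, mk u) = θ^{dA}_{Φ₁}(mk k₁, mk u) · θ^{dB}_{Φ₂}(mk k₂, mk u)` (★ `thetaKer` on representatives), i.e. [HarrisKudlaSweet1996, §1 Lem. 1.1]'s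
  restriction of the doubled theta kernel to `ι(G × G)` in the `L⁺`-rational Schrödinger model, with NO character.

No definition, no instance, no named fact, no `sorry`; axioms ⊆ {propext, Classical.choice, Quot.sound}.

## References
* [HarrisKudlaSweet1996] M. Harris, S. Kudla, W. J. Sweet, *Theta dichotomy for unitary groups*, J. AMS 9 (1996), §1 (1.8)–(1.11), Lem. 1.1 p. 953.
* [Kudla1994] S. Kudla, *Splitting metaplectic covers of dual reductive pairs*, Israel J. Math. 87 (1994), §2, §3 Thm. 3.1.
* [Kudla1984] S. Kudla, *Seesaw dual reductive pairs*, Progr. Math. 46 (1984), §1.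
* [Weil1964] A. Weil, Acta Math. 111 (1964), Chap. III n° 41 Thm. 6 p. 193.
* [Liu2021] Y. Liu, *Fourier–Jacobi cycles and arithmetic relative trace formula*, Camb. J. Math. 9 (2021), App. B (B.7), §B.3 p. 101.

HONEST LABEL: HC_CM is proved only modulo the 7 printed citations (2 remaining named inputs: hLiu418 = stmt-HodgeConjecture-24832, h413 =
stmt-HodgeConjecture-24833) until rung 0 closes; this helper moves no counter.
-/

set_option autoImplicit false

set_option linter.dupNamespace false

noncomputable section

open scoped Classical
open scoped Matrix Kronecker
open NumberField IsDedekindDomain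
open Literature.RepresentationTheory.HeisenbergGroup
open Literature.NumberTheory.Automorphic
open Literature.NumberTheory.Weil1964
open Literature.RepresentationTheory.HarrisKudlaSweet1996
open Literature.NumberTheory.GaloisRepresentations

namespace Summit.HodgeConjecture.HodgeConjecture.Cruxes.HLiu418.K2LiuDoubledKernelUndoubling

open Literature.NumberTheory.Automorphic.UnitaryGroup
open Literature.NumberTheory.Automorphic.IdeleClassGroup
open Literature.NumberTheory.GelbartRogawski1991 Literature.NumberTheory.GelbartRogawski1991.UnitaryDualPair
open Literature.NumberTheory.GelbartRogawski1991.GRConstruction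
open Literature.NumberTheory.Automorphic.Liu2021 Literature.NumberTheory.Automorphic.Liu2021.Def411WeilCarriers
open Literature.NumberTheory.Automorphic.Liu2021.Def411WeilCarriersDoubling
open Literature.NumberTheory.K2Lit.DoubledLineTheta
open Literature.RepresentationTheory.Liu2021
open Summit.HodgeConjecture.HodgeConjecture.Cruxes.HLiu418.K2LiuDoubledSeesawBothSlots
open Summit.HodgeConjecture.HodgeConjecture.Cruxes.HLiu418.K2LiuLineThetaKernelMirror (lineThetaKer_mk_eq_thetaDistLM)

/-! ## §1 Matrix bookkeeping -/

section Matrices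

variable {R : Type*} [CommRing R] {n M : ℕ}

/-- **`reindex e_Σ e_Σ (h ⊗ u) = diag(k₁ ⊗ u, k₂ ⊗ u)`** for `h = reindex e₂ e₂ (diag(k₁, k₂))` (`e₂ = finSumFinEquiv`,
`e_Σ = (finSumFinEquiv × 1)⁻¹ ≫ sumProdDistrib`). [cite: Kudla1984, §1] -/
theorem reindex_kronecker_blockDiag (k₁ k₂ : Matrix (Fin n) (Fin n) R) (u : Matrix (Fin M) (Fin M) R) :
    Matrix.reindex
        ((finSumFinEquiv.prodCongr (Equiv.refl (Fin M))).symm.trans (Equiv.sumProdDistrib (Fin n) (Fin n) (Fin M)))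
        ((finSumFinEquiv.prodCongr (Equiv.refl (Fin M))).symm.trans (Equiv.sumProdDistrib (Fin n) (Fin n) (Fin M)))
        (Matrix.reindex (finSumFinEquiv (m := n) (n := n)) (finSumFinEquiv (m := n) (n := n)) (Matrix.fromBlocks k₁ 0 0 k₂) ⊗ₖ u) =
      Matrix.fromBlocks (k₁ ⊗ₖ u) 0 0 (k₂ ⊗ₖ u) := by
  ext a b
  rcases a with ⟨i, x⟩ | ⟨i, x⟩ <;> rcases b with ⟨j, y⟩ | ⟨j, y⟩ <;>
    simp only [Matrix.reindex_apply, Matrix.submatrix_apply, Equiv.symm_trans_apply, Equiv.symm_symm,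
      Equiv.sumProdDistrib_symm_apply_left, Equiv.sumProdDistrib_symm_apply_right, Equiv.prodCongr_apply, Prod.map_apply,
      Equiv.coe_refl, id_eq, Matrix.kroneckerMap_apply, Equiv.symm_apply_apply, Matrix.fromBlocks_apply₁₁,
      Matrix.fromBlocks_apply₁₂, Matrix.fromBlocks_apply₂₁, Matrix.fromBlocks_apply₂₂, Matrix.zero_apply, zero_mul]

end Matrices

section Pair

variable (F E : Type) [Field F] [NumberField F] [Field E] [NumberField E] [Algebra F E]
variable (c : E ≃ₐ[F] E) {N M : ℕ} (JV : Matrix (Fin N) (Fin N) E) (JW : Matrix (Fin M) (Fin M) E)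

omit [NumberField F] in
/-- `(k ⊗ 1)·(1 ⊗ u) = k ⊗ u` in `G₁(𝔸) = U(J_V ⊗ J_W)(𝔸)` (matrices). [cite: GelbartRogawski1991, §3.2 p. 457] -/
theorem coe_adelicInl_mul_adelicInr (k : UnitaryGroup.adelic F E c N JV) (u : UnitaryGroup.adelic F E c M JW) :
    (((UnitaryGroup.adelicInl F E c N M JV JW k * UnitaryGroup.adelicInr F E c N M JV JW u :
        UnitaryGroup.adelicPair F E c N M JV JW) : GL (Fin N × Fin M) (AdeleRing (𝓞 E) E)) :
        Matrix (Fin N × Fin M) (Fin N × Fin M) (AdeleRing (𝓞 E) E)) =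
      ((k : GL (Fin N) (AdeleRing (𝓞 E) E)) : Matrix (Fin N) (Fin N) (AdeleRing (𝓞 E) E)) ⊗ₖ
        ((u : GL (Fin M) (AdeleRing (𝓞 E) E)) : Matrix (Fin M) (Fin M) (AdeleRing (𝓞 E) E)) := by
  rw [Subgroup.coe_mul, Units.val_mul, UnitaryGroup.coe_adelicInl, UnitaryGroup.coe_adelicInr, ← Matrix.mul_kronecker_mul,
    Matrix.mul_one, Matrix.one_mul]

end Pair

/-! ## §2 The both-slot identity in D8's frame `dD = (t₀ ‖ −t₀) ∘ finSumFinEquiv⁻¹` -/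

section Frame

variable (L : Type) [Field L] [NumberField L] [IsCMField L]
variable {N M n : ℕ} (e : Fin N × Fin M ≃ Fin n)
  (dV : Fin N → L) (hdV : ∀ i, IsCMField.complexConj L (dV i) = dV i) (hdV0 : ∀ i, dV i ≠ 0)
  (dW : Fin M → L) (hdW : ∀ i, IsCMField.complexConj L (dW i) = dW i) (hdW0 : ∀ i, dW i ≠ 0)
  {n'' n₁ n₂ M' : ℕ} (eD : Fin (n + n) × Fin M' ≃ Fin n'') (eA : Fin n × Fin M' ≃ Fin n₁) (eB : Fin n × Fin M' ≃ Fin n₂)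
  (dW' : Fin M' → L) (hdW' : ∀ i, IsCMField.complexConj L (dW' i) = dW' i) (hdW'0 : ∀ i, dW' i ≠ 0)
  (χ : HeckeCharacter L) (hχu : χ.IsUnitary) (hχs : IsSplittingChar L 1 χ)

/-- **THE BOTH-SLOT UNDOUBLING IDENTITY IN D8's FRAME** (★ `omega_chiSplitting_sumTensor_idxSplit₂` at `V₁ ⊕ V₂ := ⟨dD ∘ castAdd⟩ ⊕ ⟨dD ∘ natAdd⟩`,
partner `diag dW′`): for `h ∈ U(diag dD)(𝔸)` whose `GL`-matrix is `reindex e₂ (diag(k₁, k₂))` with `k₁ ∈ U(diag (dD ∘ castAdd))(𝔸)`,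
`k₂ ∈ U(diag (dD ∘ natAdd))(𝔸)` (the shape of ★ `coe_iotaGG` ∕ ★ `coe_toDiagA`), and `u ∈ U(diag dW′)(𝔸)`,
`ω(s_χ^{dD}(h ⊗ 1 · 1 ⊗ u)) (Φ₁ ⊠_ι Φ₂) = ω(s_χ^{dA}(k₁ ⊗ 1 · 1 ⊗ u)) Φ₁ ⊠_ι ω(s_χ^{dB}(k₂ ⊗ 1 · 1 ⊗ u)) Φ₂`.
[cite: HarrisKudlaSweet1996, §1 Lem. 1.1 p. 953, (1.8)–(1.11)] [cite: Kudla1994, §2, §3 Thm. 3.1] -/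
theorem omega_chiSplitting_dD_blockDiag
    (h : UnitaryGroup.adelic (Fp L) L (IsCMField.complexConj L) (n + n) (Matrix.diagonal (dD L e dV hdV dW hdW)))
    (k₁ : UnitaryGroup.adelic (Fp L) L (IsCMField.complexConj L) n (Matrix.diagonal fun i => dD L e dV hdV dW hdW (Fin.castAdd n i)))
    (k₂ : UnitaryGroup.adelic (Fp L) L (IsCMField.complexConj L) n (Matrix.diagonal fun i => dD L e dV hdV dW hdW (Fin.natAdd n i)))
    (hh : (h : GL (Fin (n + n)) (AdeleRing (𝓞 L) L)) =
      UnitaryGroup.reindexGL (GRConstruction.e₂ (n := n))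
        (UnitaryGroup.blockDiagGL ((k₁ : GL (Fin n) (AdeleRing (𝓞 L) L)), (k₂ : GL (Fin n) (AdeleRing (𝓞 L) L)))))
    (u : UnitaryGroup.adelic (Fp L) L (IsCMField.complexConj L) M' (Matrix.diagonal dW'))
    (Φ₁ : piSchwartzBruhat (Fp L) (Fin n₁)) (Φ₂ : piSchwartzBruhat (Fp L) (Fin n₂)) :
    adelicMpCont.omega (Fp L) (Fin n'') (gramA L eD (dD L e dV hdV dW hdW) (dD_conj L e dV hdV dW hdW) dW' hdW')
        (chiSplitting L eD (dD L e dV hdV dW hdW) (dD_conj L e dV hdV dW hdW) (dD_ne_zero L e dV hdV dW hdW hdV0 hdW0) dW' hdW' hdW'0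
          χ hχu hχs
          (UnitaryGroup.adelicInl (Fp L) L (IsCMField.complexConj L) (n + n) M' _ _ h *
            UnitaryGroup.adelicInr (Fp L) L (IsCMField.complexConj L) (n + n) M' _ _ u))
        (sumTensor (Fp L) (idxSplit eD eA eB) Φ₁ Φ₂) =
      sumTensor (Fp L) (idxSplit eD eA eB)
        (adelicMpCont.omega (Fp L) (Fin n₁)
          (gramA L eA (fun i => dD L e dV hdV dW hdW (Fin.castAdd n i)) (fun i => dD_conj L e dV hdV dW hdW (Fin.castAdd n i)) dW' hdW')
          (chiSplitting L eA (fun i => dD L e dV hdV dW hdW (Fin.castAdd n i)) (fun i => dD_conj L e dV hdV dW hdW (Fin.castAdd n i))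
            (fun i => dD_ne_zero L e dV hdV dW hdW hdV0 hdW0 (Fin.castAdd n i)) dW' hdW' hdW'0 χ hχu hχs
            (UnitaryGroup.adelicInl (Fp L) L (IsCMField.complexConj L) n M' _ _ k₁ *
              UnitaryGroup.adelicInr (Fp L) L (IsCMField.complexConj L) n M' _ _ u))
          Φ₁)
        (adelicMpCont.omega (Fp L) (Fin n₂)
          (gramA L eB (fun i => dD L e dV hdV dW hdW (Fin.natAdd n i)) (fun i => dD_conj L e dV hdV dW hdW (Fin.natAdd n i)) dW' hdW')
          (chiSplitting L eB (fun i => dD L e dV hdV dW hdW (Fin.natAdd n i)) (fun i => dD_conj L e dV hdV dW hdW (Fin.natAdd n i))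
            (fun i => dD_ne_zero L e dV hdV dW hdW hdV0 hdW0 (Fin.natAdd n i)) dW' hdW' hdW'0 χ hχu hχs
            (UnitaryGroup.adelicInl (Fp L) L (IsCMField.complexConj L) n M' _ _ k₂ *
              UnitaryGroup.adelicInr (Fp L) L (IsCMField.complexConj L) n M' _ _ u))
          Φ₂) := by
  refine omega_chiSplitting_sumTensor_idxSplit₂ L eD eA eB (fun i => dD L e dV hdV dW hdW (Fin.castAdd n i))
    (fun i => dD_conj L e dV hdV dW hdW (Fin.castAdd n i)) (fun i => dD_ne_zero L e dV hdV dW hdW hdV0 hdW0 (Fin.castAdd n i))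
    (fun i => dD L e dV hdV dW hdW (Fin.natAdd n i)) (fun i => dD_conj L e dV hdV dW hdW (Fin.natAdd n i))
    (fun i => dD_ne_zero L e dV hdV dW hdW hdV0 hdW0 (Fin.natAdd n i)) (dD L e dV hdV dW hdW) (dD_conj L e dV hdV dW hdW)
    (dD_ne_zero L e dV hdV dW hdW hdV0 hdW0) (fun _ => rfl) (fun _ => rfl) dW' hdW' hdW'0 χ hχu hχs _ _ _ ?_ Φ₁ Φ₂
  -- the matrix identity `reindex e_Σ e_Σ (h ⊗ u) = diag(k₁ ⊗ u, k₂ ⊗ u)`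
  rw [coe_adelicInl_mul_adelicInr, coe_adelicInl_mul_adelicInr, coe_adelicInl_mul_adelicInr, hh, UnitaryGroup.coe_reindexGL,
    UnitaryGroup.coe_blockDiagGL]
  exact reindex_kronecker_blockDiag _ _ _

end Frame

/-! ## §3 The kernel-level product formula at the line `⟨a′⟩` -/

section Kernel

variable (L : Type) [Field L] [NumberField L] [IsCMField L]
variable {N M n : ℕ} (e : Fin N × Fin M ≃ Fin n)
  (dV : Fin N → L) (hdV : ∀ i, IsCMField.complexConj L (dV i) = dV i) (hdV0 : ∀ i, dV i ≠ 0)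
  (dW : Fin M → L) (hdW : ∀ i, IsCMField.complexConj L (dW i) = dW i) (hdW0 : ∀ i, dW i ≠ 0)
  {n'' n₁ n₂ : ℕ} (eD : Fin (n + n) × Fin 1 ≃ Fin n'') (eA : Fin n × Fin 1 ≃ Fin n₁) (eB : Fin n × Fin 1 ≃ Fin n₂)
  (μ : Literature.NumberTheory.Automorphic.IdeleClassGroup L →ₜ* Circle) (hμ : IsConjugateSymplectic L μ) (a : (Fp L)ˣ)

/-- **`Θ(Ψ₁ ⊠_ι Ψ₂) = Θ(Ψ₁) · Θ(Ψ₂)`** — the theta distribution (sum over the rational points) of a pure tensor along any index split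
`ι : κ ≃ κ₁ ⊕ κ₂` is the product: `Σ_{ξ ∈ (L⁺)^κ} = Σ_{ξ₁} Σ_{ξ₂}` (★ `thetaDistLM_piSBReindex`, ★ `piSBReindex_sumTensor`, ★ `thetaDistLM_tensorToSum`).
[cite: Weil1964, Chap. III n° 41 Thm. 6 p. 193] [cite: MoeglinVignerasWaldspurger1987, Chap. 2 II.1 Rem. (6)] -/
theorem thetaDistLM_sumTensor {F : Type} [Field F] [NumberField F] {κ κ₁ κ₂ : Type} [Fintype κ] [DecidableEq κ] [Fintype κ₁]
    [DecidableEq κ₁] [Fintype κ₂] [DecidableEq κ₂] (ι : κ ≃ κ₁ ⊕ κ₂) (Ψ₁ : piSchwartzBruhat F κ₁) (Ψ₂ : piSchwartzBruhat F κ₂) :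
    thetaDistLM F κ (sumTensor F ι Ψ₁ Ψ₂) = thetaDistLM F κ₁ Ψ₁ * thetaDistLM F κ₂ Ψ₂ := by
  rw [← thetaDistLM_piSBReindex F ι (sumTensor F ι Ψ₁ Ψ₂), piSBReindex_sumTensor, thetaDistLM_tensorToSum]

/-- **UNDOUBLING OF D8's DOUBLED LINE-THETA KERNEL ON BLOCK-DIAGONAL ELEMENTS** — for the letter's line-theta data ★ `lineThetaKernelDatum`
at the doubled frame `(n+n, e_D, dD)` and at the two slots `(n, e_A, dD ∘ castAdd)`, `(n, e_B, dD ∘ natAdd)` (same line `⟨a⟩`, same `μ`; the Weil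
majorants `hρ_•` are the caller's), every `h ∈ U(diag dD)(𝔸)` with `GL`-matrix `reindex e₂ (diag(k₁, k₂))` and every `u ∈ U(⟨a⟩)(𝔸)`:
`θ^{dD}_{Φ₁ ⊠_ι Φ₂}(mk h, mk u) = θ^{dA}_{Φ₁}(mk k₁, mk u) · θ^{dB}_{Φ₂}(mk k₂, mk u)` (★ `thetaKer` on representatives; `ι = idxSplit e_D e_A e_B`).  This is
[HarrisKudlaSweet1996, Lem. 1.1]'s «`θ^𝔻(ι(g₁, g₂)) = θ(g₁) ⊗ θ^−(g₂)`» in the `L⁺`-rational Schrödinger model, with NO character.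
[cite: HarrisKudlaSweet1996, §1 Lem. 1.1 p. 953, (1.8)–(1.11)] [cite: Kudla1994, §2, §3 Thm. 3.1] [cite: Weil1964, Chap. III n° 41 Thm. 6 p. 193]
[cite: Liu2021, App. B (B.7), §B.3 p. 101] -/
theorem lineThetaKer_dD_blockDiag
    (hρD : HasThetaMajorants fun
      (p : ↥(UnitaryGroup.adelic (Fp L) L (IsCMField.complexConj L) (n + n) (Matrix.diagonal (dD L e dV hdV dW hdW))) ×
        ↥(UnitaryGroup.adelic (Fp L) L (IsCMField.complexConj L) 1 (JW (Fp L) L a)))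
      (Φ : piSchwartzBruhat (Fp L) (Fin n'')) =>
        pairRep (Fp L) L (IsCMField.complexConj L) (n + n) 1 eD (Matrix.diagonal (dD L e dV hdV dW hdW)) (JW (Fp L) L a)
          (chiSplittingLine L eD (dD L e dV hdV dW hdW) (dD_conj L e dV hdV dW hdW) (dD_ne_zero L e dV hdV dW hdW hdV0 hdW0)
            (toHeckeCharacter L μ) (isUnitary_toHeckeCharacter L μ)
            ((isOscillatorChar_toHeckeCharacter_iff μ).mpr hμ) (TW (Fp L) a)
            (isUnit_det_TW (Fp L) a) (JW (Fp L) L a) (JW_eq (Fp L) L a))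
          p Φ)
    (hρA : HasThetaMajorants fun
      (p : ↥(UnitaryGroup.adelic (Fp L) L (IsCMField.complexConj L) n (Matrix.diagonal fun i => dD L e dV hdV dW hdW (Fin.castAdd n i))) ×
        ↥(UnitaryGroup.adelic (Fp L) L (IsCMField.complexConj L) 1 (JW (Fp L) L a)))
      (Φ : piSchwartzBruhat (Fp L) (Fin n₁)) =>
        pairRep (Fp L) L (IsCMField.complexConj L) n 1 eA (Matrix.diagonal fun i => dD L e dV hdV dW hdW (Fin.castAdd n i)) (JW (Fp L) L a)
          (chiSplittingLine L eA (fun i => dD L e dV hdV dW hdW (Fin.castAdd n i)) (fun i => dD_conj L e dV hdV dW hdW (Fin.castAdd n i))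
            (fun i => dD_ne_zero L e dV hdV dW hdW hdV0 hdW0 (Fin.castAdd n i))
            (toHeckeCharacter L μ) (isUnitary_toHeckeCharacter L μ)
            ((isOscillatorChar_toHeckeCharacter_iff μ).mpr hμ) (TW (Fp L) a)
            (isUnit_det_TW (Fp L) a) (JW (Fp L) L a) (JW_eq (Fp L) L a))
          p Φ)
    (hρB : HasThetaMajorants fun
      (p : ↥(UnitaryGroup.adelic (Fp L) L (IsCMField.complexConj L) n (Matrix.diagonal fun i => dD L e dV hdV dW hdW (Fin.natAdd n i))) ×
        ↥(UnitaryGroup.adelic (Fp L) L (IsCMField.complexConj L) 1 (JW (Fp L) L a)))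
      (Φ : piSchwartzBruhat (Fp L) (Fin n₂)) =>
        pairRep (Fp L) L (IsCMField.complexConj L) n 1 eB (Matrix.diagonal fun i => dD L e dV hdV dW hdW (Fin.natAdd n i)) (JW (Fp L) L a)
          (chiSplittingLine L eB (fun i => dD L e dV hdV dW hdW (Fin.natAdd n i)) (fun i => dD_conj L e dV hdV dW hdW (Fin.natAdd n i))
            (fun i => dD_ne_zero L e dV hdV dW hdW hdV0 hdW0 (Fin.natAdd n i))
            (toHeckeCharacter L μ) (isUnitary_toHeckeCharacter L μ)
            ((isOscillatorChar_toHeckeCharacter_iff μ).mpr hμ) (TW (Fp L) a)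
            (isUnit_det_TW (Fp L) a) (JW (Fp L) L a) (JW_eq (Fp L) L a))
          p Φ)
    (h : UnitaryGroup.adelic (Fp L) L (IsCMField.complexConj L) (n + n) (Matrix.diagonal (dD L e dV hdV dW hdW)))
    (k₁ : UnitaryGroup.adelic (Fp L) L (IsCMField.complexConj L) n (Matrix.diagonal fun i => dD L e dV hdV dW hdW (Fin.castAdd n i)))
    (k₂ : UnitaryGroup.adelic (Fp L) L (IsCMField.complexConj L) n (Matrix.diagonal fun i => dD L e dV hdV dW hdW (Fin.natAdd n i)))
    (hh : (h : GL (Fin (n + n)) (AdeleRing (𝓞 L) L)) =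
      UnitaryGroup.reindexGL (GRConstruction.e₂ (n := n))
        (UnitaryGroup.blockDiagGL ((k₁ : GL (Fin n) (AdeleRing (𝓞 L) L)), (k₂ : GL (Fin n) (AdeleRing (𝓞 L) L)))))
    (u : UnitaryGroup.adelic (Fp L) L (IsCMField.complexConj L) 1 (JW (Fp L) L a))
    (Φ₁ : piSchwartzBruhat (Fp L) (Fin n₁)) (Φ₂ : piSchwartzBruhat (Fp L) (Fin n₂)) :
    (lineThetaKernelDatum L (n + n) eD (dD L e dV hdV dW hdW) (dD_conj L e dV hdV dW hdW) (dD_ne_zero L e dV hdV dW hdW hdV0 hdW0)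
        μ hμ a hρD).thetaKer (sumTensor (Fp L) (idxSplit eD eA eB) Φ₁ Φ₂) (QuotientGroup.mk h, QuotientGroup.mk u) =
      (lineThetaKernelDatum L n eA (fun i => dD L e dV hdV dW hdW (Fin.castAdd n i)) (fun i => dD_conj L e dV hdV dW hdW (Fin.castAdd n i))
          (fun i => dD_ne_zero L e dV hdV dW hdW hdV0 hdW0 (Fin.castAdd n i)) μ hμ a hρA).thetaKer Φ₁ (QuotientGroup.mk k₁, QuotientGroup.mk u) *
        (lineThetaKernelDatum L n eB (fun i => dD L e dV hdV dW hdW (Fin.natAdd n i)) (fun i => dD_conj L e dV hdV dW hdW (Fin.natAdd n i))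
          (fun i => dD_ne_zero L e dV hdV dW hdW hdV0 hdW0 (Fin.natAdd n i)) μ hμ a hρB).thetaKer Φ₂ (QuotientGroup.mk k₂, QuotientGroup.mk u) := by
  -- the inverse `h⁻¹` has the block matrix `reindex e₂ (diag(k₁⁻¹, k₂⁻¹))`
  have hh' : ((h⁻¹ : UnitaryGroup.adelic (Fp L) L (IsCMField.complexConj L) (n + n) (Matrix.diagonal (dD L e dV hdV dW hdW))) :
      GL (Fin (n + n)) (AdeleRing (𝓞 L) L)) =
      UnitaryGroup.reindexGL (GRConstruction.e₂ (n := n))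
        (UnitaryGroup.blockDiagGL (((k₁⁻¹ : UnitaryGroup.adelic (Fp L) L (IsCMField.complexConj L) n _) : GL (Fin n) (AdeleRing (𝓞 L) L)),
          ((k₂⁻¹ : UnitaryGroup.adelic (Fp L) L (IsCMField.complexConj L) n _) : GL (Fin n) (AdeleRing (𝓞 L) L)))) := by
    rw [Subgroup.coe_inv, Subgroup.coe_inv, Subgroup.coe_inv, hh, ← Prod.inv_mk, map_inv, map_inv]
  -- the three kernels in model currency: `θ_Φ(mk x, mk u) = Θ(ω(s(x⁻¹ ⊗ 1 · 1 ⊗ u⁻¹)) Φ)` (★ `lineThetaKer_mk_eq_thetaDistLM`)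
  have keyD := lineThetaKer_mk_eq_thetaDistLM L (n + n) eD (dD L e dV hdV dW hdW) (dD_conj L e dV hdV dW hdW)
    (dD_ne_zero L e dV hdV dW hdW hdV0 hdW0) μ hμ a hρD (sumTensor (Fp L) (idxSplit eD eA eB) Φ₁ Φ₂) h u
  have keyA := lineThetaKer_mk_eq_thetaDistLM L n eA (fun i => dD L e dV hdV dW hdW (Fin.castAdd n i))
    (fun i => dD_conj L e dV hdV dW hdW (Fin.castAdd n i)) (fun i => dD_ne_zero L e dV hdV dW hdW hdV0 hdW0 (Fin.castAdd n i)) μ hμ a hρA Φ₁ k₁ u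
  have keyB := lineThetaKer_mk_eq_thetaDistLM L n eB (fun i => dD L e dV hdV dW hdW (Fin.natAdd n i))
    (fun i => dD_conj L e dV hdV dW hdW (Fin.natAdd n i)) (fun i => dD_ne_zero L e dV hdV dW hdW hdV0 hdW0 (Fin.natAdd n i)) μ hμ a hρB Φ₂ k₂ u
  -- the line splittings read as the model splittings at `dW′ := lineW (TW a)` (★ `omega_pairSplitting_chiSplittingLine`; `pairSplitting_apply` is `rfl`)
  have eD' := omega_pairSplitting_chiSplittingLine L eD (dD L e dV hdV dW hdW) (dD_conj L e dV hdV dW hdW)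
    (dD_ne_zero L e dV hdV dW hdW hdV0 hdW0) (toHeckeCharacter L μ) (isUnitary_toHeckeCharacter L μ)
    ((isOscillatorChar_toHeckeCharacter_iff μ).mpr hμ) (TW (Fp L) a) (isUnit_det_TW (Fp L) a) (JW (Fp L) L a) (JW_eq (Fp L) L a)
    h⁻¹ u⁻¹ (sumTensor (Fp L) (idxSplit eD eA eB) Φ₁ Φ₂)
  have eA' := omega_pairSplitting_chiSplittingLine L eA (fun i => dD L e dV hdV dW hdW (Fin.castAdd n i))
    (fun i => dD_conj L e dV hdV dW hdW (Fin.castAdd n i)) (fun i => dD_ne_zero L e dV hdV dW hdW hdV0 hdW0 (Fin.castAdd n i))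
    (toHeckeCharacter L μ) (isUnitary_toHeckeCharacter L μ)
    ((isOscillatorChar_toHeckeCharacter_iff μ).mpr hμ) (TW (Fp L) a) (isUnit_det_TW (Fp L) a) (JW (Fp L) L a) (JW_eq (Fp L) L a)
    k₁⁻¹ u⁻¹ Φ₁
  have eB' := omega_pairSplitting_chiSplittingLine L eB (fun i => dD L e dV hdV dW hdW (Fin.natAdd n i))
    (fun i => dD_conj L e dV hdV dW hdW (Fin.natAdd n i)) (fun i => dD_ne_zero L e dV hdV dW hdW hdV0 hdW0 (Fin.natAdd n i))
    (toHeckeCharacter L μ) (isUnitary_toHeckeCharacter L μ)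
    ((isOscillatorChar_toHeckeCharacter_iff μ).mpr hμ) (TW (Fp L) a) (isUnit_det_TW (Fp L) a) (JW (Fp L) L a) (JW_eq (Fp L) L a)
    k₂⁻¹ u⁻¹ Φ₂
  -- §2 at `(h⁻¹, k₁⁻¹, k₂⁻¹, u⁻¹)` in model currency (`pairSplitting_apply` is `rfl`, so the three bridges chain on the nose)
  have key := omega_chiSplitting_dD_blockDiag L e dV hdV hdV0 dW hdW hdW0 eD eA eB (lineW L (TW (Fp L) a)) (complexConj_lineW L (TW (Fp L) a))
    (lineW_ne_zero L (TW (Fp L) a) (isUnit_det_TW (Fp L) a)) (toHeckeCharacter L μ) (isUnitary_toHeckeCharacter L μ)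
    ((isOscillatorChar_toHeckeCharacter_iff μ).mpr hμ) h⁻¹ k₁⁻¹ k₂⁻¹ hh'
    ((MulEquiv.subgroupCongr (congrArg (UnitaryGroup.adelic (Fp L) L (IsCMField.complexConj L) 1)
      (diagonal_lineW L (TW (Fp L) a) (JW_eq (Fp L) L a)))).symm u⁻¹) Φ₁ Φ₂
  -- assemble (term-level chaining: no `rw` motive over the line-theta telescopes)
  refine (keyD.trans (congrArg (thetaDistLM (Fp L) (Fin n'')) (eD'.trans key))).trans ?_
  refine (thetaDistLM_sumTensor (idxSplit eD eA eB) _ _).trans ?_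
  exact congrArg₂ (· * ·) (keyA.trans (congrArg (thetaDistLM (Fp L) (Fin n₁)) eA')).symm
    (keyB.trans (congrArg (thetaDistLM (Fp L) (Fin n₂)) eB')).symm

end Kernel

end Summit.HodgeConjecture.HodgeConjecture.Cruxes.HLiu418.K2LiuDoubledKernelUndoubling

end
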